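import Summits.CriticalPhenomena.PercolationContinuityZ3.Theorems.PercNearOneGluingNoHeavyLowerTailSahiCombSigmaStratumG0Gp
import Summits.CriticalPhenomena.PercolationContinuityZ3.Theorems.PercNearOneGluingNoHeavyLowerTailSahiCombTriWStratumFpGq
import Summits.CriticalPhenomena.PercolationContinuityZ3.Theorems.PercNearOneGluingNoHeavyLowerTailSahiCombTriWStrataTwo

/-!
# `TRI_W(2) ≥ 0` whenever one family misses one coordinate at the bottom (`G ∅ = G {a}`, or `F ∅ = F {a}`) — the counting bridge from the Σ-kernel theorem

Support file of the one-cut programme (crux `NoHeavyLowerTail`, stmt-CriticalPhenomena-4575; TRI lane of cell `prim-masterthm`; seat prim-lf-1 gen 27).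
Companion of `…SahiCombSigmaStratumG0Gp` (`sigma_kernel_eq_zero_stratum_G0Gp`); same two-step pattern as `…SahiCombTriWStratumFpGq`.

* `FiveUpSet.sigma_kernel_eq_zero_stratum_G0Gp_of_upperSet` — the kernel theorem inside an arbitrary up-set `P` (free restriction: a token `d ∈ P`
  only sees supplies `t ⊇ d`, which lie in `P`);
* `FiveUpSet.sigma_count_stratum_G0Gp` — the COUNTING consequence: with `A ⊆ B ⊆ J`, `A ⊆ C ⊆ J`, `D ⊆ E ⊆ H` up-sets and `P` an up-set, the
  twelve token counts (classes `L_x, R_x, K_x` inside `P`) are at most the twelve supply counts (two copies of the four fibres `P ∩ U_y` plus the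
  four tag classes) — the rows of the Σ matrix (12 row blocks × 12 column blocks, entries `κ·[d ⊆ t] + τ·[d = t]`) are linearly independent;
* **`FiveUpSet.triW_nonneg_of_stratum_G0Gp`** — for an index cube with two atoms `a ≠ b`, an up-set `P` and monotone families of up-sets `F, G`
  with `G ∅ = G {a}` (and `F` ARBITRARY): `0 ≤ triW P F G` (via `LatticeFiveUpSet.triW_nonneg_of_pair_nonneg`);
* `FiveUpSet.triW_nonneg_of_stratum_F0Fp` — the mirror `F ∅ = F {a}` (`G` arbitrary), by `triW_symm`;
* `FiveUpSet.triW_nonneg_of_bot_eq_atom` — packaged: if `F ∅ = F {c}` or `G ∅ = G {c}` for SOME atom `c`, then `0 ≤ triW P F G`.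
So at `a = 2` the conjecture `TriWIneq` is now settled on the whole locus where at least one of the two families does not separate `∅` from one
of the two atoms; it contains the strata `F ∅ = F{a} ∧ G ∅ = G{b}` (`…TriWStratumFpGq`), `F ∅ = ∅ ∧ G ∅ = G{a}` (`…TriWStrataMixed`) and the
bottom-untilted strata of `…TriWCompression` as special cases.
WHY IT MATTERS: P5 gen 15 showed the stratum `G_∅ = G_p` has NO pointwise / type-LP certificate (LP value −1/12); by prim-lf-1 gen 21's engine census
it is the largest stratum on which the Σ support calculus closes, so this file marks the boundary of the support-chase method at `a = 2`: what is
left of `TriWIneq` at `a = 2` (both families separate `∅` from both atoms) needs the global argument (memos CLOSURE §6, PRINCIPAL-AND-NOGO §3).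
HONEST LABEL: one unconditional stratum theorem (+ mirrors); `TriWIneq` / `CertSigmaKernelZero` remain OPEN. [this work]
-/

namespace Summit.CriticalPhenomena.PercolationContinuityZ3.Theorems

namespace FiveUpSet

open Finset

variable {α : Type} [DecidableEq α] [Fintype α]

/-! ### The kernel theorem inside an up-set `P` -/

/-- `sigma_kernel_eq_zero_stratum_G0Gp` inside an arbitrary up-set `P`: supports inside `P`, equations only on `P`. [this work] -/
theorem sigma_kernel_eq_zero_stratum_G0Gp_of_upperSet (P A B C J D E H : Finset (Finset α))
    (hP : IsUpperSet (P : Set (Finset α)))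
    (hA : IsUpperSet (A : Set (Finset α))) (hB : IsUpperSet (B : Set (Finset α))) (hC : IsUpperSet (C : Set (Finset α)))
    (hJ : IsUpperSet (J : Set (Finset α))) (hD : IsUpperSet (D : Set (Finset α))) (hE : IsUpperSet (E : Set (Finset α)))
    (hH : IsUpperSet (H : Set (Finset α)))
    (hAB : A ⊆ B) (hAC : A ⊆ C) (hBJ : B ⊆ J) (hCJ : C ⊆ J) (hDE : D ⊆ E) (hEH : E ⊆ H)
    (l0 lp lq l1 r0 rp rq r1 k0 kp kq k1 : Finset α → ℚ)
    (sl0 : ∀ d, l0 d ≠ 0 → d ∈ P ∧ d ∈ A ∧ dᶜ ∈ H) (slp : ∀ d, lp d ≠ 0 → d ∈ P ∧ d ∈ B ∧ dᶜ ∈ E)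
    (slq : ∀ d, lq d ≠ 0 → d ∈ P ∧ d ∈ C ∧ dᶜ ∈ D) (sl1 : ∀ d, l1 d ≠ 0 → d ∈ P ∧ d ∈ J ∧ dᶜ ∈ D)
    (sr0 : ∀ d, r0 d ≠ 0 → d ∈ P ∧ dᶜ ∈ A ∧ d ∈ H) (srp : ∀ d, rp d ≠ 0 → d ∈ P ∧ dᶜ ∈ B ∧ d ∈ E)
    (srq : ∀ d, rq d ≠ 0 → d ∈ P ∧ dᶜ ∈ C ∧ d ∈ D) (sr1 : ∀ d, r1 d ≠ 0 → d ∈ P ∧ dᶜ ∈ J ∧ d ∈ D)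
    (sk0 : ∀ d, k0 d ≠ 0 → d ∈ P ∧ dᶜ ∈ A ∧ dᶜ ∈ D) (skp : ∀ d, kp d ≠ 0 → d ∈ P ∧ dᶜ ∈ B ∧ dᶜ ∈ D)
    (skq : ∀ d, kq d ≠ 0 → d ∈ P ∧ dᶜ ∈ C ∧ dᶜ ∈ E) (sk1 : ∀ d, k1 d ≠ 0 → d ∈ P ∧ dᶜ ∈ J ∧ dᶜ ∈ H)
    (e10 : ∀ t, t ∈ P → t ∈ A → t ∈ D → zsum l0 t + zsum r0 t + zsum k0 t = 0)
    (e1p : ∀ t, t ∈ P → t ∈ B → t ∈ D → zsum l0 t + zsum r0 t + zsum rp t + zsum k0 t = 0)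
    (e1q : ∀ t, t ∈ P → t ∈ C → t ∈ E → zsum l0 t + zsum r0 t + zsum rq t + zsum k0 t = 0)
    (e11 : ∀ t, t ∈ P → t ∈ J → t ∈ H → zsum l0 t + zsum l1 t + zsum r0 t + zsum rp t + zsum rq t + zsum k0 t + zsum k1 t = 0)
    (e20 : ∀ t, t ∈ P → t ∈ A → t ∈ D → zsum l0 t = 0)
    (e2p : ∀ t, t ∈ P → t ∈ B → t ∈ D → zsum l0 t + zsum lp t + zsum rp t + zsum kp t = 0)
    (e2q : ∀ t, t ∈ P → t ∈ C → t ∈ E → zsum l0 t + zsum lq t + zsum rq t + zsum kq t = 0)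
    (e21 : ∀ t, t ∈ P → t ∈ J → t ∈ H →
      zsum l0 t + zsum lp t + zsum lq t + zsum rp t + zsum rq t + zsum r1 t + zsum kp t + zsum kq t = 0)
    (tg0 : ∀ e, e ∈ P → eᶜ ∈ A → eᶜ ∈ H → k0 e + kp e + kq e + k1 e = 0)
    (tgp : ∀ e, e ∈ P → eᶜ ∈ B → eᶜ ∈ E → kp e + k1 e = 0)
    (tgq : ∀ e, e ∈ P → eᶜ ∈ C → eᶜ ∈ D → kq e + k1 e = 0)
    (tg1 : ∀ e, e ∈ P → eᶜ ∈ J → eᶜ ∈ D → k1 e = 0) :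
    (∀ d, l0 d = 0) ∧ (∀ d, lp d = 0) ∧ (∀ d, lq d = 0) ∧ (∀ d, l1 d = 0) ∧
    (∀ d, r0 d = 0) ∧ (∀ d, rp d = 0) ∧ (∀ d, rq d = 0) ∧ (∀ d, r1 d = 0) ∧
    (∀ d, k0 d = 0) ∧ (∀ d, kp d = 0) ∧ (∀ d, kq d = 0) ∧ (∀ d, k1 d = 0) := by
  -- every zeta sum vanishes off `P`
  have nz : ∀ (f : Finset α → ℚ), (∀ d, f d ≠ 0 → d ∈ P) → ∀ t, t ∉ P → zsum f t = 0 :=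
    fun f hf t ht => zsum_eq_zero_of_not_mem hP f hf ht
  have pl0 := nz l0 (fun d hd => (sl0 d hd).1); have plp := nz lp (fun d hd => (slp d hd).1)
  have plq := nz lq (fun d hd => (slq d hd).1); have pl1 := nz l1 (fun d hd => (sl1 d hd).1)
  have pr0 := nz r0 (fun d hd => (sr0 d hd).1); have prp := nz rp (fun d hd => (srp d hd).1)
  have prq := nz rq (fun d hd => (srq d hd).1); have pr1 := nz r1 (fun d hd => (sr1 d hd).1)
  have pk0 := nz k0 (fun d hd => (sk0 d hd).1); have pkp := nz kp (fun d hd => (skp d hd).1)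
  have pkq := nz kq (fun d hd => (skq d hd).1); have pk1 := nz k1 (fun d hd => (sk1 d hd).1)
  have vz : ∀ (f : Finset α → ℚ), (∀ d, f d ≠ 0 → d ∈ P) → ∀ e, e ∉ P → f e = 0 := by
    intro f hf e he; by_contra hne; exact he (hf e hne)
  refine sigma_kernel_eq_zero_stratum_G0Gp A B C J D E H hA hB hC hJ hD hE hH hAB hAC hBJ hCJ hDE hEH
    l0 lp lq l1 r0 rp rq r1 k0 kp kq k1
    (fun d hd => (sl0 d hd).2) (fun d hd => (slp d hd).2) (fun d hd => (slq d hd).2) (fun d hd => (sl1 d hd).2)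
    (fun d hd => (sr0 d hd).2) (fun d hd => (srp d hd).2) (fun d hd => (srq d hd).2) (fun d hd => (sr1 d hd).2)
    (fun d hd => (sk0 d hd).2) (fun d hd => (skp d hd).2) (fun d hd => (skq d hd).2) (fun d hd => (sk1 d hd).2)
    ?_ ?_ ?_ ?_ ?_ ?_ ?_ ?_ ?_ ?_ ?_ ?_
  · intro t h1 h2; by_cases ht : t ∈ P
    · exact e10 t ht h1 h2
    · rw [pl0 t ht, pr0 t ht, pk0 t ht]; ring
  · intro t h1 h2; by_cases ht : t ∈ P
    · exact e1p t ht h1 h2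
    · rw [pl0 t ht, pr0 t ht, prp t ht, pk0 t ht]; ring
  · intro t h1 h2; by_cases ht : t ∈ P
    · exact e1q t ht h1 h2
    · rw [pl0 t ht, pr0 t ht, prq t ht, pk0 t ht]; ring
  · intro t h1 h2; by_cases ht : t ∈ P
    · exact e11 t ht h1 h2
    · rw [pl0 t ht, pl1 t ht, pr0 t ht, prp t ht, prq t ht, pk0 t ht, pk1 t ht]; ring
  · intro t h1 h2; by_cases ht : t ∈ P
    · exact e20 t ht h1 h2
    · exact pl0 t ht
  · intro t h1 h2; by_cases ht : t ∈ P
    · exact e2p t ht h1 h2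
    · rw [pl0 t ht, plp t ht, prp t ht, pkp t ht]; ring
  · intro t h1 h2; by_cases ht : t ∈ P
    · exact e2q t ht h1 h2
    · rw [pl0 t ht, plq t ht, prq t ht, pkq t ht]; ring
  · intro t h1 h2; by_cases ht : t ∈ P
    · exact e21 t ht h1 h2
    · rw [pl0 t ht, plp t ht, plq t ht, prp t ht, prq t ht, pr1 t ht, pkp t ht, pkq t ht]; ring
  · intro e h1 h2; by_cases he : e ∈ P
    · exact tg0 e he h1 h2
    · rw [vz k0 (fun d hd => (sk0 d hd).1) e he, vz kp (fun d hd => (skp d hd).1) e he,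
        vz kq (fun d hd => (skq d hd).1) e he, vz k1 (fun d hd => (sk1 d hd).1) e he]; ring
  · intro e h1 h2; by_cases he : e ∈ P
    · exact tgp e he h1 h2
    · rw [vz kp (fun d hd => (skp d hd).1) e he, vz k1 (fun d hd => (sk1 d hd).1) e he]; ring
  · intro e h1 h2; by_cases he : e ∈ P
    · exact tgq e he h1 h2
    · rw [vz kq (fun d hd => (skq d hd).1) e he, vz k1 (fun d hd => (sk1 d hd).1) e he]; ring
  · intro e h1 h2; by_cases he : e ∈ P
    · exact tg1 e he h1 h2
    · exact vz k1 (fun d hd => (sk1 d hd).1) e he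

/-! ### The counting theorem -/

/-- **Counting on the stratum.**  `P` an up-set, `A ⊆ B ⊆ J`, `A ⊆ C ⊆ J`, `D ⊆ E ⊆ H` up-sets (`= F_∅, F_p, F_⊤`, `F_q`; `G_∅ = G_p, G_q, G_⊤`):
the twelve token counts (inside `P`) of the Σ certificate are at most the twelve supply counts:
`Σ_x (#L_x + #R_x + #K_x) ≤ 2·Σ_y #U_y + Σ_x #T4_x` in the seven-up-set presentation. [this work] -/
theorem sigma_count_stratum_G0Gp (P A B C J D E H : Finset (Finset α)) (hP : IsUpperSet (P : Set (Finset α)))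
    (hA : IsUpperSet (A : Set (Finset α))) (hB : IsUpperSet (B : Set (Finset α))) (hC : IsUpperSet (C : Set (Finset α)))
    (hJ : IsUpperSet (J : Set (Finset α))) (hD : IsUpperSet (D : Set (Finset α))) (hE : IsUpperSet (E : Set (Finset α)))
    (hH : IsUpperSet (H : Set (Finset α)))
    (hAB : A ⊆ B) (hAC : A ⊆ C) (hBJ : B ⊆ J) (hCJ : C ⊆ J) (hDE : D ⊆ E) (hEH : E ⊆ H) :
    ((P ∩ A ∩ refl H).card + (P ∩ B ∩ refl E).card + (P ∩ C ∩ refl D).card + (P ∩ J ∩ refl D).card)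
      + ((P ∩ refl A ∩ H).card + (P ∩ refl B ∩ E).card + (P ∩ refl C ∩ D).card + (P ∩ refl J ∩ D).card)
      + ((P ∩ refl A ∩ refl D).card + (P ∩ refl B ∩ refl D).card + (P ∩ refl C ∩ refl E).card + (P ∩ refl J ∩ refl H).card)
    ≤ 2 * ((P ∩ A ∩ D).card + (P ∩ B ∩ D).card + (P ∩ C ∩ E).card + (P ∩ J ∩ H).card)
      + ((P ∩ refl A ∩ refl H).card + (P ∩ refl B ∩ refl E).card + (P ∩ refl C ∩ refl D).card + (P ∩ refl J ∩ refl D).card) := by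
  -- token sets (rows) and supply/tag sets (columns), indexed by `Fin 12`
  set S : Fin 12 → Finset (Finset α) := fun i =>
    match i with
    | 0 => P ∩ A ∩ refl H | 1 => P ∩ B ∩ refl E | 2 => P ∩ C ∩ refl D | 3 => P ∩ J ∩ refl D
    | 4 => P ∩ refl A ∩ H | 5 => P ∩ refl B ∩ E | 6 => P ∩ refl C ∩ D | 7 => P ∩ refl J ∩ D
    | 8 => P ∩ refl A ∩ refl D | 9 => P ∩ refl B ∩ refl D | 10 => P ∩ refl C ∩ refl E | 11 => P ∩ refl J ∩ refl H
    with hSdef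
  set T : Fin 12 → Finset (Finset α) := fun j =>
    match j with
    | 0 => P ∩ A ∩ D | 1 => P ∩ B ∩ D | 2 => P ∩ C ∩ E | 3 => P ∩ J ∩ H
    | 4 => P ∩ A ∩ D | 5 => P ∩ B ∩ D | 6 => P ∩ C ∩ E | 7 => P ∩ J ∩ H
    | 8 => P ∩ refl A ∩ refl H | 9 => P ∩ refl B ∩ refl E | 10 => P ∩ refl C ∩ refl D | 11 => P ∩ refl J ∩ refl D
    with hTdef
  -- the Σ table: class code `c = i / 4` (0 = L, 1 = R, 2 = K), index code `x = i % 4` (0=∅,1=p,2=q,3=⊤); column `j < 8`: fibre `j % 4`, copy `j / 4`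
  set κ : Fin 12 → Fin 12 → ℚ := fun i j =>
    if j.val < 8 ∧ (i.val % 4 = 0 ∨ i.val % 4 = j.val % 4 ∨ j.val % 4 = 3) ∧
      ((i.val / 4 = 0 ∧ (i.val % 4 = 0 ∨ ((i.val % 4 = 1 ∨ i.val % 4 = 2) ∧ j.val / 4 = 1) ∨ (i.val % 4 = 3 ∧ j.val / 4 = 0))) ∨
       (i.val / 4 = 1 ∧ ((i.val % 4 = 0 ∧ j.val / 4 = 0) ∨ (i.val % 4 = 1 ∨ i.val % 4 = 2) ∨ (i.val % 4 = 3 ∧ j.val / 4 = 1))) ∨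
       (i.val / 4 = 2 ∧ ((i.val % 4 = 0 ∧ j.val / 4 = 0) ∨ ((i.val % 4 = 1 ∨ i.val % 4 = 2) ∧ j.val / 4 = 1) ∨ (i.val % 4 = 3 ∧ j.val / 4 = 0))))
    then (1 : ℚ) else 0 with hκdef
  set τ : Fin 12 → Fin 12 → ℚ := fun i j =>
    if 8 ≤ j.val ∧ i.val / 4 = 2 ∧ (j.val - 8 = 0 ∨ j.val - 8 = i.val % 4 ∨ i.val % 4 = 3) then (1 : ℚ) else 0 with hτdef
  let v : (Σ i : Fin 12, ↥(S i)) → (Σ j : Fin 12, ↥(T j)) → ℚ := fun r c =>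
    κ r.1 c.1 * (if (r.2 : Finset α) ⊆ (c.2 : Finset α) then (1 : ℚ) else 0)
      + τ r.1 c.1 * (if (r.2 : Finset α) = (c.2 : Finset α) then (1 : ℚ) else 0)
  have hli : LinearIndependent ℚ v := by
    rw [Fintype.linearIndependent_iff]
    intro g hg
    -- extended coefficient vectors
    have hext : ∀ i : Fin 12, ∃ a : Finset α → ℚ, ∀ d, a d = if h : d ∈ S i then g ⟨i, ⟨d, h⟩⟩ else 0 :=
      fun i => ⟨_, fun _ => rfl⟩
    choose a ha using hext
    have hsupp : ∀ i d, a i d ≠ 0 → d ∈ S i := by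
      intro i d hd; by_contra h; rw [ha i d, dif_neg h] at hd; exact hd rfl
    -- the column equations
    have hcol : ∀ (j : Fin 12) (t : Finset α), t ∈ T j →
        ∑ i : Fin 12, (κ i j * zsum (a i) t + τ i j * a i t) = 0 := by
      intro j t ht
      have h := congrFun hg ⟨j, ⟨t, ht⟩⟩
      rw [Finset.sum_apply, Fintype.sum_sigma] at h
      simp only [Pi.smul_apply, smul_eq_mul, Pi.zero_apply] at h
      rw [← h]
      refine sum_congr rfl fun i _ => ?_
      have e1 : ∑ d : ↥(S i), g ⟨i, d⟩ * v ⟨i, d⟩ ⟨j, ⟨t, ht⟩⟩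
          = ∑ d : ↥(S i), g ⟨i, d⟩
              * (κ i j * (if (d : Finset α) ⊆ t then (1 : ℚ) else 0) + τ i j * (if (d : Finset α) = t then (1 : ℚ) else 0)) := rfl
      have e3 := sum_subtype_ext (S i) (fun d' => g ⟨i, d'⟩) (a i) (ha i)
        (fun e => κ i j * (if e ⊆ t then (1 : ℚ) else 0) + τ i j * (if e = t then (1 : ℚ) else 0))
      rw [e1, e3]
      unfold zsum
      have e2 : ∑ d, a i d * (if d = t then (1 : ℚ) else 0) = a i t := by
        rw [Finset.sum_eq_single t]
        · simp
        · intro d _ hdt; rw [if_neg hdt, mul_zero]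
        · intro h; exact absurd (mem_univ t) h
      rw [← e2, mul_sum, mul_sum, ← sum_add_distrib]
      refine sum_congr rfl fun d _ => ?_
      ring
    -- read off the eight fibre equations and four tag equations
    have e10 : ∀ t, t ∈ P → t ∈ A → t ∈ D → zsum (a 0) t + zsum (a 4) t + zsum (a 8) t = 0 := by
      intro t h1 h2 h3
      have h := hcol 0 t (mem_inter.2 ⟨mem_inter.2 ⟨h1, h2⟩, h3⟩)
      simp [Fin.sum_univ_succ, hκdef, hτdef] at h
      linarith
    have e1p : ∀ t, t ∈ P → t ∈ B → t ∈ D → zsum (a 0) t + zsum (a 4) t + zsum (a 5) t + zsum (a 8) t = 0 := by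
      intro t h1 h2 h3
      have h := hcol 1 t (mem_inter.2 ⟨mem_inter.2 ⟨h1, h2⟩, h3⟩)
      simp [Fin.sum_univ_succ, hκdef, hτdef] at h
      linarith
    have e1q : ∀ t, t ∈ P → t ∈ C → t ∈ E → zsum (a 0) t + zsum (a 4) t + zsum (a 6) t + zsum (a 8) t = 0 := by
      intro t h1 h2 h3
      have h := hcol 2 t (mem_inter.2 ⟨mem_inter.2 ⟨h1, h2⟩, h3⟩)
      simp [Fin.sum_univ_succ, hκdef, hτdef] at h
      linarith
    have e11 : ∀ t, t ∈ P → t ∈ J → t ∈ H → zsum (a 0) t + zsum (a 3) t + zsum (a 4) t + zsum (a 5) t + zsum (a 6) t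
        + zsum (a 8) t + zsum (a 11) t = 0 := by
      intro t h1 h2 h3
      have h := hcol 3 t (mem_inter.2 ⟨mem_inter.2 ⟨h1, h2⟩, h3⟩)
      simp [Fin.sum_univ_succ, hκdef, hτdef] at h
      linarith
    have e20 : ∀ t, t ∈ P → t ∈ A → t ∈ D → zsum (a 0) t = 0 := by
      intro t h1 h2 h3
      have h := hcol 4 t (mem_inter.2 ⟨mem_inter.2 ⟨h1, h2⟩, h3⟩)
      simp [Fin.sum_univ_succ, hκdef, hτdef] at h
      linarith
    have e2p : ∀ t, t ∈ P → t ∈ B → t ∈ D → zsum (a 0) t + zsum (a 1) t + zsum (a 5) t + zsum (a 9) t = 0 := by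
      intro t h1 h2 h3
      have h := hcol 5 t (mem_inter.2 ⟨mem_inter.2 ⟨h1, h2⟩, h3⟩)
      simp [Fin.sum_univ_succ, hκdef, hτdef] at h
      linarith
    have e2q : ∀ t, t ∈ P → t ∈ C → t ∈ E → zsum (a 0) t + zsum (a 2) t + zsum (a 6) t + zsum (a 10) t = 0 := by
      intro t h1 h2 h3
      have h := hcol 6 t (mem_inter.2 ⟨mem_inter.2 ⟨h1, h2⟩, h3⟩)
      simp [Fin.sum_univ_succ, hκdef, hτdef] at h
      linarith
    have e21 : ∀ t, t ∈ P → t ∈ J → t ∈ H → zsum (a 0) t + zsum (a 1) t + zsum (a 2) t + zsum (a 5) t + zsum (a 6) t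
        + zsum (a 7) t + zsum (a 9) t + zsum (a 10) t = 0 := by
      intro t h1 h2 h3
      have h := hcol 7 t (mem_inter.2 ⟨mem_inter.2 ⟨h1, h2⟩, h3⟩)
      simp [Fin.sum_univ_succ, hκdef, hτdef] at h
      linarith
    have tg0 : ∀ e, e ∈ P → eᶜ ∈ A → eᶜ ∈ H → a 8 e + a 9 e + a 10 e + a 11 e = 0 := by
      intro e h1 h2 h3
      have h := hcol 8 e (mem_inter.2 ⟨mem_inter.2 ⟨h1, mem_refl.2 h2⟩, mem_refl.2 h3⟩)
      simp [Fin.sum_univ_succ, hκdef, hτdef] at h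
      linarith
    have tgp : ∀ e, e ∈ P → eᶜ ∈ B → eᶜ ∈ E → a 9 e + a 11 e = 0 := by
      intro e h1 h2 h3
      have h := hcol 9 e (mem_inter.2 ⟨mem_inter.2 ⟨h1, mem_refl.2 h2⟩, mem_refl.2 h3⟩)
      simp [Fin.sum_univ_succ, hκdef, hτdef] at h
      linarith
    have tgq : ∀ e, e ∈ P → eᶜ ∈ C → eᶜ ∈ D → a 10 e + a 11 e = 0 := by
      intro e h1 h2 h3
      have h := hcol 10 e (mem_inter.2 ⟨mem_inter.2 ⟨h1, mem_refl.2 h2⟩, mem_refl.2 h3⟩)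
      simp [Fin.sum_univ_succ, hκdef, hτdef] at h
      linarith
    have tg1 : ∀ e, e ∈ P → eᶜ ∈ J → eᶜ ∈ D → a 11 e = 0 := by
      intro e h1 h2 h3
      have h := hcol 11 e (mem_inter.2 ⟨mem_inter.2 ⟨h1, mem_refl.2 h2⟩, mem_refl.2 h3⟩)
      simp [Fin.sum_univ_succ, hκdef, hτdef] at h
      linarith
    -- supports
    have m3 : ∀ {X Y : Finset (Finset α)} {d : Finset α}, d ∈ P ∩ X ∩ Y → d ∈ P ∧ d ∈ X ∧ d ∈ Y := by
      intro X Y d h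
      exact ⟨(mem_inter.1 (mem_inter.1 h).1).1, (mem_inter.1 (mem_inter.1 h).1).2, (mem_inter.1 h).2⟩
    have K := sigma_kernel_eq_zero_stratum_G0Gp_of_upperSet P A B C J D E H hP hA hB hC hJ hD hE hH hAB hAC hBJ hCJ hDE hEH
      (a 0) (a 1) (a 2) (a 3) (a 4) (a 5) (a 6) (a 7) (a 8) (a 9) (a 10) (a 11)
      (fun d hd => by obtain ⟨h1, h2, h3⟩ := m3 (hsupp 0 d hd); exact ⟨h1, h2, mem_refl.1 h3⟩)
      (fun d hd => by obtain ⟨h1, h2, h3⟩ := m3 (hsupp 1 d hd); exact ⟨h1, h2, mem_refl.1 h3⟩)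
      (fun d hd => by obtain ⟨h1, h2, h3⟩ := m3 (hsupp 2 d hd); exact ⟨h1, h2, mem_refl.1 h3⟩)
      (fun d hd => by obtain ⟨h1, h2, h3⟩ := m3 (hsupp 3 d hd); exact ⟨h1, h2, mem_refl.1 h3⟩)
      (fun d hd => by obtain ⟨h1, h2, h3⟩ := m3 (hsupp 4 d hd); exact ⟨h1, mem_refl.1 h2, h3⟩)
      (fun d hd => by obtain ⟨h1, h2, h3⟩ := m3 (hsupp 5 d hd); exact ⟨h1, mem_refl.1 h2, h3⟩)
      (fun d hd => by obtain ⟨h1, h2, h3⟩ := m3 (hsupp 6 d hd); exact ⟨h1, mem_refl.1 h2, h3⟩)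
      (fun d hd => by obtain ⟨h1, h2, h3⟩ := m3 (hsupp 7 d hd); exact ⟨h1, mem_refl.1 h2, h3⟩)
      (fun d hd => by obtain ⟨h1, h2, h3⟩ := m3 (hsupp 8 d hd); exact ⟨h1, mem_refl.1 h2, mem_refl.1 h3⟩)
      (fun d hd => by obtain ⟨h1, h2, h3⟩ := m3 (hsupp 9 d hd); exact ⟨h1, mem_refl.1 h2, mem_refl.1 h3⟩)
      (fun d hd => by obtain ⟨h1, h2, h3⟩ := m3 (hsupp 10 d hd); exact ⟨h1, mem_refl.1 h2, mem_refl.1 h3⟩)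
      (fun d hd => by obtain ⟨h1, h2, h3⟩ := m3 (hsupp 11 d hd); exact ⟨h1, mem_refl.1 h2, mem_refl.1 h3⟩)
      e10 e1p e1q e11 e20 e2p e2q e21 tg0 tgp tgq tg1
    obtain ⟨K0, K1, K2, K3, K4, K5, K6, K7, K8, K9, K10, K11⟩ := K
    have hall : ∀ i d, a i d = 0 := by
      intro i
      fin_cases i
      exacts [K0, K1, K2, K3, K4, K5, K6, K7, K8, K9, K10, K11]
    rintro ⟨i, ⟨d, hd⟩⟩
    have h := hall i d
    rwa [ha i d, dif_pos hd] at h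
  -- count: independent vectors are at most the dimension
  have hcard := hli.fintype_card_le_finrank
  rw [Module.finrank_fintype_fun_eq_card, Fintype.card_sigma, Fintype.card_sigma] at hcard
  simp [Fin.sum_univ_succ, hSdef, hTdef, -Finset.inter_assoc] at hcard
  omega

/-! ### `TRI_W(2) ≥ 0` on the stratum and its mirrors -/

/-- **`TRI_W(2) ≥ 0` on the stratum `G ∅ = G {a}`** (index cube with two atoms `a ≠ b`; `P` an up-set; `F, G` monotone families of up-sets, `F`
arbitrary).  Proof: pair reduction `LatticeFiveUpSet.triW_nonneg_of_pair_nonneg` + the counting theorem `sigma_count_stratum_G0Gp` with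
`(A,B,C,J,D,E,H) = (F ∅, F {a}, F {b}, F univ, G ∅, G {b}, G univ)` — the sum of the outer and inner thin-edge functionals is exactly supplies minus
demands of the Σ certificate.  P5 gen 15: no pointwise / type-LP certificate exists on this stratum (−1/12). [this work] -/
theorem triW_nonneg_of_stratum_G0Gp {β : Type} [DecidableEq β] [Fintype β] {a b : β} (hab : a ≠ b) (hu : (univ : Finset β) = {a, b})
    (P : Finset (Finset α)) (F G : Finset β → Finset (Finset α))
    (hP : IsUpperSet (P : Set (Finset α))) (hF : ∀ x, IsUpperSet (F x : Set (Finset α))) (hG : ∀ x, IsUpperSet (G x : Set (Finset α)))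
    (hFm : Monotone F) (hGm : Monotone G) (hGa : G ∅ = G {a}) : 0 ≤ triW P F G := by
  refine LatticeFiveUpSet.triW_nonneg_of_pair_nonneg hab hu P F G ?_
  have hcount := sigma_count_stratum_G0Gp P (F ∅) (F {a}) (F {b}) (F univ) (G ∅) (G {b}) (G univ) hP
    (hF ∅) (hF {a}) (hF {b}) (hF univ) (hG ∅) (hG {b}) (hG univ)
    (hFm (empty_subset _)) (hFm (empty_subset _)) (hFm (subset_univ _)) (hFm (subset_univ _))
    (hGm (empty_subset _)) (hGm (subset_univ _))
  rw [← hGa]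
  unfold LatticeFiveUpSet.triWOne
  simp only [image_complEquiv]
  have hcount' : (((P ∩ F ∅ ∩ refl (G univ)).card : ℤ) + (P ∩ F {a} ∩ refl (G {b})).card + (P ∩ F {b} ∩ refl (G ∅)).card
        + (P ∩ F univ ∩ refl (G ∅)).card)
      + (((P ∩ refl (F ∅) ∩ G univ).card : ℤ) + (P ∩ refl (F {a}) ∩ G {b}).card + (P ∩ refl (F {b}) ∩ G ∅).card
        + (P ∩ refl (F univ) ∩ G ∅).card)
      + (((P ∩ refl (F ∅) ∩ refl (G ∅)).card : ℤ) + (P ∩ refl (F {a}) ∩ refl (G ∅)).card + (P ∩ refl (F {b}) ∩ refl (G {b})).card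
        + (P ∩ refl (F univ) ∩ refl (G univ)).card)
    ≤ 2 * (((P ∩ F ∅ ∩ G ∅).card : ℤ) + (P ∩ F {a} ∩ G ∅).card + (P ∩ F {b} ∩ G {b}).card + (P ∩ F univ ∩ G univ).card)
      + (((P ∩ refl (F ∅) ∩ refl (G univ)).card : ℤ) + (P ∩ refl (F {a}) ∩ refl (G {b})).card + (P ∩ refl (F {b}) ∩ refl (G ∅)).card
        + (P ∩ refl (F univ) ∩ refl (G ∅)).card) := by exact_mod_cast hcount
  linarith

/-- The mirror stratum `F ∅ = F {a}` (`G` arbitrary): `0 ≤ triW P F G`, by `triW_symm`. [this work] -/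
theorem triW_nonneg_of_stratum_F0Fp {β : Type} [DecidableEq β] [Fintype β] {a b : β} (hab : a ≠ b) (hu : (univ : Finset β) = {a, b})
    (P : Finset (Finset α)) (F G : Finset β → Finset (Finset α))
    (hP : IsUpperSet (P : Set (Finset α))) (hF : ∀ x, IsUpperSet (F x : Set (Finset α))) (hG : ∀ x, IsUpperSet (G x : Set (Finset α)))
    (hFm : Monotone F) (hGm : Monotone G) (hFa : F ∅ = F {a}) : 0 ≤ triW P F G := by
  rw [triW_symm]
  exact triW_nonneg_of_stratum_G0Gp hab hu P G F hP hG hF hGm hFm hFa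

/-- **Packaged form.**  Two-atom index cube, `P` an up-set, `F, G` monotone families of up-sets: if for SOME atom `c` one of the two families
does not separate the bottom from `{c}` (`F ∅ = F {c}` or `G ∅ = G {c}`), then `0 ≤ triW P F G`. [this work] -/
theorem triW_nonneg_of_bot_eq_atom {β : Type} [DecidableEq β] [Fintype β] {a b : β} (hab : a ≠ b) (hu : (univ : Finset β) = {a, b})
    (P : Finset (Finset α)) (F G : Finset β → Finset (Finset α))
    (hP : IsUpperSet (P : Set (Finset α))) (hF : ∀ x, IsUpperSet (F x : Set (Finset α))) (hG : ∀ x, IsUpperSet (G x : Set (Finset α)))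
    (hFm : Monotone F) (hGm : Monotone G) (c : β) (hc : F ∅ = F {c} ∨ G ∅ = G {c}) : 0 ≤ triW P F G := by
  have hu' : (univ : Finset β) = {b, a} := by rw [hu, pair_comm]
  have hcab : c = a ∨ c = b := by
    have := mem_univ c
    rw [hu, mem_insert, mem_singleton] at this
    exact this
  rcases hcab with rfl | rfl
  · rcases hc with h | h
    · exact triW_nonneg_of_stratum_F0Fp hab hu P F G hP hF hG hFm hGm h
    · exact triW_nonneg_of_stratum_G0Gp hab hu P F G hP hF hG hFm hGm h
  · rcases hc with h | h
    · exact triW_nonneg_of_stratum_F0Fp hab.symm hu' P F G hP hF hG hFm hGm h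
    · exact triW_nonneg_of_stratum_G0Gp hab.symm hu' P F G hP hF hG hFm hGm h

end FiveUpSet

end Summit.CriticalPhenomena.PercolationContinuityZ3.Theorems
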